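import Summits.NavierStokesRegularity.NavierStokesRegularity.Theorems.EfficiencyFloorEnstrophyQuarterLawDssStratum
import Literature.Analysis.FluidPDE.AncientSimilarityVariables
import Literature.Analysis.FluidPDE.TsaiSelfSimilarBounded
import Literature.Analysis.FluidPDE.ClassicalSolutionGlue
import Literature.Analysis.FluidPDE.AxisymQuotientRayAverage
import HarnessLib

/-!
# The CONTINUOUSLY self-similar sub-stratum of the crux `EfficiencyFloor.ProductionEfficiencyDecay`
# (stmt-NavierStokesRegularity-22866) is EMPTY: no maximal smooth Leray–Hopf rapidly-decaying-datum solution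
# is backward self-similar about its blow-up time (Leray's 1934 question, in the route's own class)

`--supports stmt-NavierStokesRegularity-22866 --as helper` (line `efficiency_floor`; seat ns-ef-p3). Companion to
`EfficiencyFloorEnstrophyQuarterLawDssStratum.lean` (the residual holds on the DSS stratum) and to the lead's
`dssStratumRung_iff_not_DssLerayHopfBlowup` (the BC5 rung `stub_dssStratumRung` IS the exclusion of exactly-DSS
blow-up). This file removes the degenerate corner of that stratum: the factor-`c`-for-EVERY-`c` (continuously
self-similar, Leray 1934 (3.11)) blow-ups do not exist in the crux's class, by Nečas–Růžička–Šverák 1996 / Tsai 1998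
as discharged in the tree — so the rung's open content is GENUINELY discrete self-similarity (one factor `λ > 1`,
log-periodic `Z√(T−t)`), exactly the object of the route's `why it might fail` line.

THE THEOREM (`not_isSelfSimilar_of_maximal`). Let `(u,p)` be a maximal smooth solution of unforced Navier–Stokes on
`ℝ³ × [0,T)` (`ν, T > 0`), Leray–Hopf from its rapidly decaying datum. Then `s ↦ u(T + s)` is NOT self-similar
(`¬ IsSelfSimilar (fun s x => u (T + s) x)`, i.e. not `c • u(T + c²s, c x) = u(T + s, x)` for all `c > 0`).

PROOF (all handles in tree). (1) Time translation: `(w,q) = (u(T+·), p(T+·))` is classical on `(−T, 0)`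
(`IsClassicalNSSolutionOn.comp_add_right`, `.mono`). (2) Similarity variables (Chae–Wolf 2017 §4,
`isClassicalNSSolutionOn_iff_isBackwardLeraySolutionOn_lerayOrbit`): `(lerayOrbit w, lerayOrbitPressure q)` solves
the backward Leray system on `τ⁻¹((−T,0))`, which contains `s₀ = log(2/T)` (`τ(s₀) = −T/2`). (3) Self-similarity
makes the orbit steady, `lerayOrbit w s = w(−1)` (`IsSelfSimilar.lerayOrbit_eq`), so `∂ₛU = 0` and Leray's form of
the momentum equation at `s₀` says `(w(−1), lerayOrbitPressure q s₀)` is a Leray profile `IsLerayProfile ν (1/2)`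
(pattern of `OddMorawetz…SelfSimilarRigidity.isLerayProfile_of_isSelfSimilar`, here with viscosity `ν` and a finite
past). (4) The profile is bounded: `w(−1) = lerayOrbit w s₀ = √(T/2)·u(T/2, √(T/2)·)` and the slice `u(T/2)` of a
Tao/Chae-class solution is bounded (`EnstrophyBudget.isLocalSolution`,
`HasBoundedSobolevNormsOn.exists_forall_norm_iteratedFDeriv_le`). (5) Tsai 1998, Thm 1 at `q = ∞`
(`IsLerayProfile.exists_eq_const_of_bounded`, discharged): `w(−1) ≡ b`, so every slice `u(t)`, `t < T`, is the
constant `(√(T−t))⁻¹ • b` (`eq_lerayOrbit_of_neg`) and has ZERO enstrophy — contradicting the divergence of the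
enstrophy at blow-up (`BlowupEnstrophyUnbounded.main`, stmt-22867, landed).

CONSEQUENCE (`selfSimilarStratumRung`): the BC5 rung with `IsSelfSimilar` in place of `∃ c > 1,
IsDiscretelySelfSimilar c` holds outright (vacuously) — verbatim the rung's binder prefix and conclusion.

HONEST FRAMING: an exclusion theorem for a HYPOTHETICAL degenerate blow-up geometry, transported from the tree's
proved barrier facts; the DSS rung, the crux stmt-22866 and NS regularity all stay open; no summit is proved.
[cite: Tsai1998, Thm 1 (p. 31); NecasRuzickaSverak1996, Thm 1; ChaeWolf2017RemovingDSS, §4]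
-/

-- the problem directory repeats the summit name (`NavierStokesRegularity/NavierStokesRegularity`)
set_option linter.dupNamespace false

noncomputable section

open Set Filter MeasureTheory Topology
open scoped ENNReal NNReal ContDiff
open Literature.Analysis.FluidPDE

namespace Summit.NavierStokesRegularity.NavierStokesRegularity.Theorems

namespace SelfSimilarStratum

variable {ν T : ℝ} {u : ℝ → EuclideanSpace ℝ (Fin 3) → EuclideanSpace ℝ (Fin 3)}
  {p : ℝ → EuclideanSpace ℝ (Fin 3) → ℝ}

/-- **Time translation to the blow-up time**: if `(u,p)` is classical on `[0,T)`, then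
`(u(T+·), p(T+·))` is a classical unforced solution on the open past window `(−T, 0)`. [folklore] -/
theorem isClassicalNSSolutionOn_shift (hcl : IsClassicalNSSolutionOn (Ico 0 T) ν 0 u p) :
    IsClassicalNSSolutionOn (Ioo (-T) 0) ν 0 (fun s x => u (T + s) x) (fun s x => p (T + s) x) := by
  have h := hcl.comp_add_right T
  have hsub : Ioo (-T) 0 ⊆ (· + T) ⁻¹' Ico 0 T := fun s hs => ⟨by linarith [hs.1], by linarith [hs.2]⟩
  have h' := h.mono hsub (uniqueDiffOn_Ioo (-T) 0)
  have hu : (fun s x => u (T + s) x) = fun t => u (t + T) := by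
    funext s x; rw [add_comm]
  have hp : (fun s x => p (T + s) x) = fun t => p (t + T) := by
    funext s x; rw [add_comm]
  have hf : (fun t : ℝ => (0 : ℝ → EuclideanSpace ℝ (Fin 3) → EuclideanSpace ℝ (Fin 3)) (t + T)) = 0 := by
    funext t; rfl
  rw [hu, hp]
  rw [hf] at h'
  exact h'

/-- **A self-similar classical blow-up has a steady Leray profile.** If `(u,p)` is classical on `[0,T)`, `T > 0`,
and `w = u(T+·)` is self-similar, then `U = w(−1)` together with the orbit pressure at the similarity time
`s₀ = log(2/T)` is a Leray profile with rate `a = ½` and viscosity `ν`: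
`−νΔU + ½U + ½(y·∇)U + (U·∇)U + ∇P = 0`, `div U = 0` (Leray 1934 (3.11)–(3.12); Chae–Wolf 2017 §4).
[cite: ChaeWolf2017RemovingDSS, §4] -/
theorem exists_isLerayProfile_of_isSelfSimilar (hT : 0 < T) (hcl : IsClassicalNSSolutionOn (Ico 0 T) ν 0 u p)
    (hss : IsSelfSimilar (fun s x => u (T + s) x)) :
    ∃ P : EuclideanSpace ℝ (Fin 3) → ℝ, IsLerayProfile ν (1 / 2) ((fun s x => u (T + s) x) (-1)) P := by
  set w : ℝ → EuclideanSpace ℝ (Fin 3) → EuclideanSpace ℝ (Fin 3) := fun s x => u (T + s) x with hw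
  set q : ℝ → EuclideanSpace ℝ (Fin 3) → ℝ := fun s x => p (T + s) x with hq
  have hclw : IsClassicalNSSolutionOn (Ioo (-T) 0) ν 0 w q := isClassicalNSSolutionOn_shift hcl
  have hL := (isClassicalNSSolutionOn_iff_isBackwardLeraySolutionOn_lerayOrbit isOpen_Ioo
    Ioo_subset_Iio_self).1 hclw
  set S : Set ℝ := ancientSimTime ⁻¹' Ioo (-T) 0 with hSdef
  -- the similarity time `s₀ = log (2/T)`, `τ(s₀) = −T/2 ∈ (−T, 0)`
  set s₀ : ℝ := Real.log (2 / T) with hs₀def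
  have hτ : Real.exp (-s₀) = T / 2 := by
    rw [hs₀def, Real.exp_neg, Real.exp_log (by positivity), inv_div]
  have hs : s₀ ∈ S := by
    rw [hSdef, mem_preimage, ancientSimTime_apply, hτ, mem_Ioo]
    constructor <;> linarith
  have horb : lerayOrbit w s₀ = w (-1) := hss.lerayOrbit_eq s₀
  refine ⟨lerayOrbitPressure q s₀, ?_, ?_, fun y => ?_, ?_⟩
  · rw [← horb]
    exact (hL.smooth_velocity.contDiff_slice hs).of_le (by norm_cast)
  · exact (hL.smooth_pressure.contDiff_slice hs).of_le (by norm_cast)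
  · have hm := hL.momentum_leray hs y
    have hD : timeDerivWithin S (lerayOrbit w) s₀ y = 0 := by
      simp only [timeDerivWithin_apply, hss.lerayOrbit_eq, derivWithin_fun_const, Pi.zero_apply]
    rw [hD, zero_add, horb] at hm
    rw [← hm]
    abel
  · rw [← horb]
    exact hL.divFree s₀ hs

/-- **No continuously self-similar blow-up in the crux's class.** A maximal smooth solution of unforced
Navier–Stokes on `ℝ³ × [0,T)` (`ν, T > 0`), Leray–Hopf from its rapidly decaying datum, is NOT backward self-similar
about `(T, 0)`: otherwise its steady Leray profile `U = u(T−1)`-orbit is bounded (it is a rescaled bounded slice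
`u(T/2)` of a Tao-class solution), hence constant by Tsai 1998, Thm 1 (`q = ∞`, discharged in tree), so every slice
`u(t)`, `t < T`, is spatially constant with zero enstrophy — while blow-up forces the enstrophy to diverge
(`BlowupEnstrophyUnbounded.main`, stmt-22867). [cite: Tsai1998, Thm 1 (p. 31)] -/
theorem not_isSelfSimilar_of_maximal (hν : 0 < ν) (hT : 0 < T) (hmax : IsMaximalSmoothSolution ν 0 u p T)
    (hLH : IsLerayHopfOn T ν 0 (u 0) u) (hdec : HasRapidSpatialDecay (u 0)) :
    ¬ IsSelfSimilar (fun s x => u (T + s) x) := by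
  intro hss
  set w : ℝ → EuclideanSpace ℝ (Fin 3) → EuclideanSpace ℝ (Fin 3) := fun s x => u (T + s) x with hw
  obtain ⟨P, hprof⟩ := exists_isLerayProfile_of_isSelfSimilar hT hmax.isClassicalNSSolutionOn hss
  -- (4) the profile `w(−1) = lerayOrbit w s₀` is bounded, `s₀ = log(2/T)`, through the bounded slice `u(T/2)`
  set s₀ : ℝ := Real.log (2 / T) with hs₀def
  have hτ : Real.exp (-s₀) = T / 2 := by
    rw [hs₀def, Real.exp_neg, Real.exp_log (by positivity), inv_div]
  have horb : lerayOrbit w s₀ = w (-1) := hss.lerayOrbit_eq s₀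
  have hLS := EnstrophyBudget.isLocalSolution hν hT hmax.isClassicalNSSolutionOn hLH hdec
  have hH : HasBoundedSobolevNormsOn (Icc 0 (T / 2)) u := hLS.sobolev (T / 2) (by linarith)
  have hsm : ∀ t ∈ Icc 0 (T / 2), ContDiff ℝ ∞ (u t) := fun t ht =>
    hmax.isClassicalNSSolutionOn.contDiff_velocity ⟨ht.1, by linarith [ht.2]⟩
  obtain ⟨B, -, hB⟩ := hH.exists_forall_norm_iteratedFDeriv_le hsm 0
  have hslice : ∀ x, ‖u (T / 2) x‖ ≤ B := fun x => by
    have h := hB (T / 2) ⟨by linarith, le_rfl⟩ x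
    rwa [norm_iteratedFDeriv_zero] at h
  have hbdd : ∃ M : ℝ, ∀ y, ‖w (-1) y‖ ≤ M := by
    refine ⟨Real.exp (-s₀ / 2) * B, fun y => ?_⟩
    rw [← horb, lerayOrbit_apply, norm_smul, Real.norm_eq_abs, abs_of_pos (Real.exp_pos _)]
    refine mul_le_mul_of_nonneg_left ?_ (Real.exp_pos _).le
    have ht2 : T + -Real.exp (-s₀) = T / 2 := by rw [hτ]; ring
    simp only [hw, ht2]
    exact hslice _
  -- (5) Tsai: the bounded profile is constant
  obtain ⟨b, hb⟩ := hprof.exists_eq_const_of_bounded hν (by norm_num) hbdd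
  have hb' : ∀ y, w (-1) y = b := hb
  -- every slice `u t`, `0 < t < T`, is the constant `(√(T−t))⁻¹ • b`
  have hconst : ∀ t ∈ Ioo 0 T, ∀ x, u t x = (Real.sqrt (T - t))⁻¹ • b := by
    intro t ht x
    have hneg : t - T < 0 := by linarith [ht.2]
    have h := eq_lerayOrbit_of_neg w hneg x
    rw [hss.lerayOrbit_eq, hb'] at h
    have h1 : w (t - T) x = u t x := by simp only [hw, add_sub_cancel]
    rw [← h1, h, show -(t - T) = T - t by ring]
  -- hence zero enstrophy on `(0,T)`
  have hZ0 : ∀ t ∈ Ioo 0 T, ∫⁻ x, ‖curl (u t) x‖ₑ ^ 2 = 0 := by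
    intro t ht
    have hu : u t = fun _ => (Real.sqrt (T - t))⁻¹ • b := funext (hconst t ht)
    have hcurl : ∀ x, curl (u t) x = 0 := fun x => by
      rw [hu]
      ext i
      fin_cases i <;> simp [curl]
    simp [hcurl]
  -- against the divergence of the enstrophy at blow-up
  have hev := BlowupEnstrophyUnbounded.main hν hT hmax hLH hdec 1
  obtain ⟨t, h1, htI⟩ := (hev.and (Ioo_mem_nhdsLT hT)).exists
  rw [hZ0 t htI, ENNReal.ofReal_one] at h1
  exact one_ne_zero (le_zero_iff.1 h1)

/-- **The BC5 rung on the continuously self-similar sub-stratum holds outright** (the skeleton's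
`stub_dssStratumRung` with `IsSelfSimilar` — every factor `c > 0` — in place of one factor `c > 1`): vacuously, by
`not_isSelfSimilar_of_maximal`. The genuinely open content of the rung is DISCRETE self-similarity. [folklore] -/
theorem selfSimilarStratumRung : ∀ (ν T : ℝ), 0 < ν → 0 < T →
    ∀ (u : ℝ → EuclideanSpace ℝ (Fin 3) → EuclideanSpace ℝ (Fin 3)) (p : ℝ → EuclideanSpace ℝ (Fin 3) → ℝ),
    Literature.Analysis.FluidPDE.IsMaximalSmoothSolution ν 0 u p T →
    Literature.Analysis.FluidPDE.IsLerayHopfOn T ν 0 (u 0) u →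
    Literature.Analysis.FluidPDE.HasRapidSpatialDecay (u 0) →
    Literature.Analysis.FluidPDE.IsSelfSimilar (fun s x => u (T + s) x) →
    ∀ ε : ℝ, 0 < ε → ∃ t₁ ∈ Set.Ico 0 T, (∀ t ∈ Set.Ico t₁ T,
      0 < ∫⁻ x, ‖Literature.Analysis.FluidPDE.curl (u t) x‖ₑ ^ 2 ∧
        ∫⁻ x, ‖Literature.Analysis.FluidPDE.curl (u t) x‖ₑ ^ 2 < ⊤) ∧
      ∀ s t : ℝ, t₁ ≤ s → s ≤ t → t < T →
        ((∫⁻ x, ‖Literature.Analysis.FluidPDE.curl (u s) x‖ₑ ^ 2).toReal)⁻¹ ^ 2 -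
            ((∫⁻ x, ‖Literature.Analysis.FluidPDE.curl (u t) x‖ₑ ^ 2).toReal)⁻¹ ^ 2 ≤ ε * (t - s) := by
  intro ν T hν hT u p hmax hLH hdec hss
  exact absurd hss (not_isSelfSimilar_of_maximal hν hT hmax hLH hdec)

end SelfSimilarStratum

end Summit.NavierStokesRegularity.NavierStokesRegularity.Theorems

end
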